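import Summits.AtomisticToContinuum.Crystallization.Theorems.ThreeConeCertificateSlackRigidityPricedFloorsDefs
import Summits.AtomisticToContinuum.Crystallization.Theorems.PhononSlackCertificatesPeriodicGivenLayeredLayerCake
import Summits.AtomisticToContinuum.Crystallization.Theorems.ChargedEnergyGap.Negative.Unconditional
import HarnessLib

/-!
# `SlackRigidity` (stmt-AtomisticToContinuum-11960), line `priced-floors-palm-exactification`, stub S3
# (`stub_layeredMeanSelection`): the mean layer energy of a window of layers is at least `2e*`

Lead c19, S3 energetics, part 2 (deterministic).  GIVEN the free lower bound (L) for separated sets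
(registered sub-goal `stub_windowLowerBound` of the line, a hazard-free port of `LayeredHull.wb_lower`;
taken here as a HYPOTHESIS so that this file does not wait for it), every window of `n` consecutive
layers of an admissible layered set has total layer energy

  `Σ_{m ∈ [m₁, m₁+n)} (Φ₀(a) + Σ'_{m'≠m} Φ(z m' − z m, L m' − L m)) ≥ 2 n e* − C`

with ONE constant `C` (uniform in the data, the window and `n`): apply (L) to the prisms
`W(m₁, n, K)` of the layered set itself (`LayeredHull.cake_prisms`: `#W = nK²`, `Σ_W e_p = K² · Σ_m(layer
energies)`, `∂W ≤ 192 (nK + K²)`), use `N e* ≤ E(N)` (`ChargedEnergyGapNegative.eStar_le_groundStateEnergy_div`)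
and let `K → ∞`.  Registered sub-goal `lms_window_sum_ge`.  All `[folklore]`.
-/

noncomputable section

open MeasureTheory Filter Set
open scoped ENNReal BigOperators Topology

namespace Summit.AtomisticToContinuum.Crystallization.Theorems.SlackRigidityPricedFloorsWindow

open Literature.MathematicalPhysics.StatisticalMechanics
open Summit.AtomisticToContinuum.Crystallization.Theorems.SlackRigidityPricedFloors
open Summit.AtomisticToContinuum.Crystallization.Theorems.LayeredHull
open Summit.AtomisticToContinuum.Crystallization.Theorems.MinimiserShells.Negative.LoadBearing (eStar)

/-- `e* ≤ E(N)/N` in the form `2 N e* ≤ 2 E(N)` for `N ≥ 1`. [folklore] -/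
theorem two_mul_card_mul_eStar_le {N : ℕ} (hN : 0 < N) :
    2 * (N : ℝ) * eStar ≤ 2 * groundStateEnergy lennardJones 3 N := by
  have h := ChargedEnergyGapNegative.eStar_le_groundStateEnergy_div hN
  have hNr : (0 : ℝ) < N := by exact_mod_cast hN
  rw [le_div_iff₀ hNr] at h
  change eStar * N ≤ _ at h
  nlinarith

/-- A real number below `b + c/K` for every `K ≥ 1` is at most `b`. [folklore] -/
theorem le_of_forall_le_add_div {x b c : ℝ} (h : ∀ K : ℕ, 1 ≤ K → x ≤ b + c / K) : x ≤ b := by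
  refine le_of_forall_pos_le_add fun ε hε => ?_
  obtain ⟨K, hK⟩ := exists_nat_gt (c / ε)
  have hK1 : 1 ≤ K + 1 := by omega
  have hKr : (0 : ℝ) < ((K + 1 : ℕ) : ℝ) := by positivity
  have hle : c / ((K + 1 : ℕ) : ℝ) ≤ ε := by
    rw [div_le_iff₀ hKr]
    rw [div_lt_iff₀ hε] at hK
    push_cast
    nlinarith
  linarith [h (K + 1) hK1]

/-- The arithmetic of one prism: `2E − M·bd ≤ K²T`, `bd ≤ 192(nK + K²)`, `2nK²e* ≤ 2E` give
`2ne* − 192M ≤ T + 192Mn/K`. [folklore] -/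
theorem prism_arith {T bd E M e n K : ℝ} (hLW : 2 * E - M * bd ≤ K ^ 2 * T)
    (hbd : bd ≤ 192 * (n * K + K ^ 2)) (hE : 2 * (n * K ^ 2) * e ≤ 2 * E) (hM : 0 ≤ M) (hK : 0 < K) :
    2 * n * e - 192 * M ≤ T + 192 * M * n / K := by
  have h1 := mul_le_mul_of_nonneg_left hbd hM
  have hmain : 2 * n * K ^ 2 * e - 192 * M * (n * K + K ^ 2) ≤ K ^ 2 * T := by linarith
  have hK2 : (0 : ℝ) < K ^ 2 := by positivity
  have h2 := div_le_div_of_nonneg_right hmain hK2.le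
  have h3 : K ^ 2 * T / K ^ 2 = T := by field_simp
  have h4 : (2 * n * K ^ 2 * e - 192 * M * (n * K + K ^ 2)) / K ^ 2 =
      2 * n * e - 192 * M - 192 * M * n / K := by
    field_simp
    ring
  rw [h3, h4] at h2
  linarith

/-- **Window sum lower bound** (registered sub-goal `lms_window_sum_ge`).  Given the free lower
bound (L) for separated sets, the total layer energy of any `n` consecutive layers of an admissible
layered set is at least `2 n e* − C`, one constant `C` for all data, windows and `n`. [folklore] -/
theorem lms_window_sum_ge : (∀ δ : ℝ, 0 < δ → ∃ C : ℝ, ∀ S : Set E3, (∀ p ∈ S, ∀ q ∈ S, p ≠ q → δ ≤ dist p q) → ∀ W : Finset E3, (↑W : Set E3) ⊆ S → 2 * groundStateEnergy lennardJones 3 W.card - C * ∑ p ∈ W, (1 + Metric.infDist p (S \ (↑W : Set E3)))⁻¹ ^ 3 ≤ ∑ p ∈ W, (∑' q : {q : E3 // q ∈ S ∧ q ≠ p}, lennardJones (dist p (q : E3)))) → ∃ C : ℝ, ∀ (A : E3 →ₗᵢ[ℝ] E3) (a : ℝ) (s : ℤ → ℤ) (z : ℤ → ℝ), 47 / 50 ≤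 a → a ≤ 1 → (∀ m : ℤ, 39 / 50 * a ≤ z (m + 1) - z m) → ∀ (m₁ : ℤ) (n : ℕ), 2 * (n : ℝ) * eStar - C ≤ ∑ m ∈ Finset.Ico m₁ (m₁ + n), (inLayerInteraction lennardJones a + ∑' m' : ℤ, if m' = m then (0 : ℝ) else layerInteraction lennardJones a (z m' - z m) (haggLabel s m' - haggLabel s m) 1) := by
  intro hL
  obtain ⟨C, hC⟩ := hL (1 / 2) (by norm_num)
  -- the boundary constant of (L) may be taken nonnegative
  have hC0 : ∀ (S : Set E3), (∀ p ∈ S, ∀ q ∈ S, p ≠ q → (1 / 2 : ℝ) ≤ dist p q) →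
      ∀ W : Finset E3, (↑W : Set E3) ⊆ S →
        2 * groundStateEnergy lennardJones 3 W.card -
            max C 0 * ∑ p ∈ W, (1 + Metric.infDist p (S \ (↑W : Set E3)))⁻¹ ^ 3 ≤
          ∑ p ∈ W, (∑' q : {q : E3 // q ∈ S ∧ q ≠ p}, lennardJones (dist p (q : E3))) := by
    intro S hS W hW
    have h := hC S hS W hW
    have hsum : 0 ≤ ∑ p ∈ W, (1 + Metric.infDist p (S \ (↑W : Set E3)))⁻¹ ^ 3 :=
      Finset.sum_nonneg fun p _ => pow_nonneg (inv_nonneg.2 (by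
        linarith [Metric.infDist_nonneg (x := p) (s := S \ (↑W : Set E3))])) 3
    nlinarith [le_max_left C 0, mul_le_mul_of_nonneg_right (le_max_left C 0) hsum]
  refine ⟨192 * max C 0, fun A a s z ha ha1 hz m₁ n => ?_⟩
  have hCm : 0 ≤ max C 0 := le_max_right _ _
  -- empty window
  rcases Nat.eq_zero_or_pos n with rfl | hn
  · simp only [CharP.cast_eq_zero, mul_zero, zero_mul, zero_sub, add_zero, Finset.Ico_self,
      Finset.sum_empty, neg_nonpos]
    positivity
  -- for every `K ≥ 1`: `2 n e* ≤ T + 192 max(C,0) (1 + n/K)`, by (L) on the prism `W(m₁, n, K)`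
  refine le_of_forall_le_add_div (c := 192 * max C 0 * n) fun K hK1 => ?_
  have hKr : (0 : ℝ) < K := by exact_mod_cast hK1
  obtain ⟨hWS, hcard, hsumW, hbdry⟩ := cake_prisms a ha ha1 A s z hz m₁ n K _ rfl _ rfl
  have hsep := cake_separated a ha A s z hz
  have hLW := hC0 _ hsep _ hWS
  rw [hsumW, hcard] at hLW
  have hE := two_mul_card_mul_eStar_le (N := n * K ^ 2) (Nat.mul_pos hn (by positivity))
  push_cast at hE
  exact prism_arith hLW hbdry hE hCm hKr

end Summit.AtomisticToContinuum.Crystallization.Theorems.SlackRigidityPricedFloorsWindow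

end
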